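/-
Copyright (c) 2026. All rights reserved.
Released under Apache 2.0 license as described in the file LICENSE.
-/
import Summits.Parity.BatemanHorn.Theorems.SoloInformedThreeRangeSchema

/-!
# Proper prime powers of the form `n² + 1` and `ψ = θ + O(x^{5/6})`

First half of the classical glue from the `ψ`-form `∑_{n ≤ x} Λ(n²+1) ~ 𝔖 x` to
`HardyLittlewoodConjE`: `n² + 1 = p^k` with `k ≥ 2` forces `k ≥ 3` (`n² + 1`, `n ≥ 1`, is
never a square), so the `n ≤ x` with `n² + 1` a proper prime power number
`≤ log₂(x²+1) · (x²+1)^{1/3}` and their von Mangoldt weight is `≤ 5184 x^{5/6} = o(x)`.  The partial summation is in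
`SoloInformedSchemaToConjE`.
-/

namespace Summit.Parity.BatemanHorn.Theorems

open Finset Filter ArithmeticFunction Asymptotics
open scoped ArithmeticFunction.Moebius Topology
open Literature.NumberTheory.Sieve (hardyLittlewoodEConst hardyLittlewoodEConst_pos
  nSqAddOnePrimeCount HardyLittlewoodConjE hardyLittlewoodConjE_iff_isEquivalent)
open Literature.NumberTheory.Sieve.Iwaniec1978 (rho rem)

/-! ### Proper prime powers of the form `n² + 1` -/

/-- `n² + 1` is not a perfect square when `n ≥ 1`. -/
theorem sq_add_one_ne_sq {n : ℕ} (hn : 1 ≤ n) (m : ℕ) : n ^ 2 + 1 ≠ m ^ 2 := by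
  intro h
  rcases Nat.lt_or_ge n m with hm | hm
  · have : (n + 1) ^ 2 ≤ m ^ 2 := Nat.pow_le_pow_left hm 2
    nlinarith
  · have : m ^ 2 ≤ n ^ 2 := Nat.pow_le_pow_left hm 2
    omega

/-- If `n² + 1` (`n ≥ 1`) is a prime power but not a prime, then it is `p ^ k` with `k ≥ 3`. -/
theorem exists_eq_pow_three_le {n : ℕ} (hn : 1 ≤ n) (h : IsPrimePow (n ^ 2 + 1))
    (hnp : ¬Nat.Prime (n ^ 2 + 1)) : ∃ p k : ℕ, p.Prime ∧ 3 ≤ k ∧ p ^ k = n ^ 2 + 1 := by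
  obtain ⟨p, k, hp, hk, hpk⟩ := (isPrimePow_nat_iff _).mp h
  refine ⟨p, k, hp, ?_, hpk⟩
  by_contra hk3
  push Not at hk3
  interval_cases k
  · exact hnp (by rw [← hpk, pow_one]; exact hp)
  · exact sq_add_one_ne_sq hn p hpk.symm

/-- The `n ≤ x` with `n² + 1` a proper prime power number at most
`log₂(x²+1) · ⌊(x²+1)^{1/3}⌋`. -/
theorem card_properPrimePow_le (x : ℕ) :
    #((Icc 1 x).filter fun n : ℕ => ¬Nat.Prime (n ^ 2 + 1) ∧ IsPrimePow (n ^ 2 + 1))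
      ≤ Nat.log 2 (x ^ 2 + 1) * ⌊((x : ℝ) ^ 2 + 1) ^ (3 : ℝ)⁻¹⌋₊ := by
  calc #((Icc 1 x).filter fun n : ℕ => ¬Nat.Prime (n ^ 2 + 1) ∧ IsPrimePow (n ^ 2 + 1))
      ≤ #((Icc 1 (Nat.log 2 (x ^ 2 + 1))
            ×ˢ Icc 1 ⌊((x : ℝ) ^ 2 + 1) ^ (3 : ℝ)⁻¹⌋₊).image
          fun kp : ℕ × ℕ => kp.2 ^ kp.1) := by
        refine card_le_card_of_injOn (fun n : ℕ => n ^ 2 + 1) (fun n hn => ?_) ?_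
        · simp only [mem_coe, mem_filter, mem_Icc] at hn
          obtain ⟨p, k, hp, hk, hpk⟩ := exists_eq_pow_three_le hn.1.1 hn.2.2 hn.2.1
          simp only [mem_coe, mem_image]
          refine ⟨(k, p), ?_, hpk⟩
          rw [mem_product, mem_Icc, mem_Icc]
          have hle : p ^ k ≤ x ^ 2 + 1 := by
            rw [hpk]; exact Nat.add_le_add_right (Nat.pow_le_pow_left hn.1.2 2) 1
          refine ⟨⟨by omega, ?_⟩, hp.one_lt.le, ?_⟩
          · exact Nat.le_log_of_pow_le (by norm_num)
              ((Nat.pow_le_pow_left hp.two_le k).trans hle)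
          · refine Nat.le_floor ?_
            have h3 : (p : ℝ) ^ (3 : ℝ) ≤ (x : ℝ) ^ 2 + 1 := by
              rw [show (3 : ℝ) = ((3 : ℕ) : ℝ) by norm_num, Real.rpow_natCast]
              exact_mod_cast (Nat.pow_le_pow_right hp.pos hk).trans hle
            exact (Real.le_rpow_inv_iff_of_pos (by positivity) (by positivity)
              (by norm_num)).mpr h3
        · intro a _ b _ h
          have h' : a ^ 2 = b ^ 2 := by simpa using h
          exact Nat.pow_left_injective (by norm_num) h'
    _ ≤ #(Icc 1 (Nat.log 2 (x ^ 2 + 1))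
          ×ˢ Icc 1 ⌊((x : ℝ) ^ 2 + 1) ^ (3 : ℝ)⁻¹⌋₊) := card_image_le
    _ = Nat.log 2 (x ^ 2 + 1) * ⌊((x : ℝ) ^ 2 + 1) ^ (3 : ℝ)⁻¹⌋₊ := by
        rw [card_product, Nat.card_Icc, Nat.card_Icc, Nat.add_sub_cancel, Nat.add_sub_cancel]

/-- Real form of the count: `≤ 4 log(x²+1) · x^{2/3}` for `x ≥ 1`. -/
theorem card_properPrimePow_real_le {x : ℕ} (hx : 1 ≤ x) :
    (#((Icc 1 x).filter fun n : ℕ => ¬Nat.Prime (n ^ 2 + 1) ∧ IsPrimePow (n ^ 2 + 1)) : ℝ)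
      ≤ 4 * Real.log ((x : ℝ) ^ 2 + 1) * (x : ℝ) ^ (2 / 3 : ℝ) := by
  have hX : (1 : ℝ) ≤ x := by exact_mod_cast hx
  have hN0 : (0 : ℝ) < (x : ℝ) ^ 2 + 1 := by positivity
  have hlogN : 0 ≤ Real.log ((x : ℝ) ^ 2 + 1) := Real.log_nonneg (by nlinarith)
  have hK : (Nat.log 2 (x ^ 2 + 1) : ℝ) ≤ 2 * Real.log ((x : ℝ) ^ 2 + 1) := by
    have h2 : (2 : ℝ) ^ Nat.log 2 (x ^ 2 + 1) ≤ (x : ℝ) ^ 2 + 1 := by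
      exact_mod_cast Nat.pow_log_le_self 2 (by positivity : x ^ 2 + 1 ≠ 0)
    have h3 : (Nat.log 2 (x ^ 2 + 1) : ℝ) * Real.log 2 ≤ Real.log ((x : ℝ) ^ 2 + 1) := by
      rw [← Real.log_pow]; exact Real.log_le_log (by positivity) h2
    have hl2 : (1 / 2 : ℝ) ≤ Real.log 2 := by linarith [Real.log_two_gt_d9]
    have hK0 : (0 : ℝ) ≤ Nat.log 2 (x ^ 2 + 1) := by positivity
    calc (Nat.log 2 (x ^ 2 + 1) : ℝ) = 2 * ((Nat.log 2 (x ^ 2 + 1) : ℝ) * (1 / 2)) := by ring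
      _ ≤ 2 * ((Nat.log 2 (x ^ 2 + 1) : ℝ) * Real.log 2) := by
          have := mul_le_mul_of_nonneg_left hl2 hK0
          linarith
      _ ≤ 2 * Real.log ((x : ℝ) ^ 2 + 1) := by linarith
  have hR : (⌊((x : ℝ) ^ 2 + 1) ^ (3 : ℝ)⁻¹⌋₊ : ℝ)
      ≤ 2 * (x : ℝ) ^ (2 / 3 : ℝ) := by
    refine (Nat.floor_le (by positivity)).trans ?_
    rw [Real.rpow_inv_le_iff_of_pos hN0.le (by positivity) (by norm_num),
      Real.mul_rpow (by norm_num) (by positivity),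
      ← Real.rpow_mul (show (0 : ℝ) ≤ (x : ℝ) by positivity),
      show (2 / 3 : ℝ) * 3 = ((2 : ℕ) : ℝ) by norm_num, Real.rpow_natCast,
      show (3 : ℝ) = ((3 : ℕ) : ℝ) by norm_num, Real.rpow_natCast]
    nlinarith
  calc (#((Icc 1 x).filter fun n : ℕ => ¬Nat.Prime (n ^ 2 + 1) ∧ IsPrimePow (n ^ 2 + 1)) : ℝ)
      ≤ (Nat.log 2 (x ^ 2 + 1) : ℝ) * ⌊((x : ℝ) ^ 2 + 1) ^ (3 : ℝ)⁻¹⌋₊ := by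
        exact_mod_cast card_properPrimePow_le x
    _ ≤ (2 * Real.log ((x : ℝ) ^ 2 + 1)) * (2 * (x : ℝ) ^ (2 / 3 : ℝ)) :=
        mul_le_mul hK hR (by positivity) (mul_nonneg (by norm_num) hlogN)
    _ = 4 * Real.log ((x : ℝ) ^ 2 + 1) * (x : ℝ) ^ (2 / 3 : ℝ) := by ring

/-! ### `ψ = θ + O(x^{5/6})` -/

/-- `ψ`-form = `θ`-form + the proper prime powers. -/
theorem sum_vonMangoldt_eq_theta_add (x : ℕ) :
    ∑ n ∈ Icc 1 x, Λ (n ^ 2 + 1)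
      = ∑ n ∈ (Icc 1 x).filter (fun n : ℕ => Nat.Prime (n ^ 2 + 1)),
            Real.log ((n ^ 2 + 1 : ℕ) : ℝ)
        + ∑ n ∈ (Icc 1 x).filter
            (fun n : ℕ => ¬Nat.Prime (n ^ 2 + 1) ∧ IsPrimePow (n ^ 2 + 1)),
            Λ (n ^ 2 + 1) := by
  rw [← sum_filter_add_sum_filter_not (Icc 1 x) (fun n : ℕ => Nat.Prime (n ^ 2 + 1)),
    ← sum_filter_add_sum_filter_not ((Icc 1 x).filter fun n : ℕ => ¬Nat.Prime (n ^ 2 + 1))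
      (fun n : ℕ => IsPrimePow (n ^ 2 + 1))]
  have h0 : ∑ n ∈ ((Icc 1 x).filter fun n : ℕ => ¬Nat.Prime (n ^ 2 + 1)).filter
      (fun n : ℕ => ¬IsPrimePow (n ^ 2 + 1)), Λ (n ^ 2 + 1) = 0 :=
    sum_eq_zero fun n hn => vonMangoldt_eq_zero_iff.mpr (mem_filter.mp hn).2
  rw [h0, add_zero, filter_filter]
  congr 1
  exact sum_congr rfl fun n hn => by rw [vonMangoldt_apply_prime (mem_filter.mp hn).2]

/-- The proper-prime-power part is nonnegative. -/
theorem properPrimePow_sum_nonneg (x : ℕ) :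
    0 ≤ ∑ n ∈ (Icc 1 x).filter
      (fun n : ℕ => ¬Nat.Prime (n ^ 2 + 1) ∧ IsPrimePow (n ^ 2 + 1)), Λ (n ^ 2 + 1) :=
  sum_nonneg fun _ _ => vonMangoldt_nonneg

/-- The proper-prime-power part is at most `#(exceptional set) · log(x²+1)`. -/
theorem properPrimePow_sum_le (x : ℕ) :
    ∑ n ∈ (Icc 1 x).filter (fun n : ℕ => ¬Nat.Prime (n ^ 2 + 1) ∧ IsPrimePow (n ^ 2 + 1)),
        Λ (n ^ 2 + 1)
      ≤ #((Icc 1 x).filter fun n : ℕ => ¬Nat.Prime (n ^ 2 + 1) ∧ IsPrimePow (n ^ 2 + 1))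
          * Real.log ((x : ℝ) ^ 2 + 1) := by
  rw [← nsmul_eq_mul]
  refine sum_le_card_nsmul _ _ _ fun n hn => ?_
  have hn' : n ≤ x := (mem_Icc.mp (mem_filter.mp hn).1).2
  have hnR : (n : ℝ) ≤ x := by exact_mod_cast hn'
  calc Λ (n ^ 2 + 1) ≤ Real.log ((n ^ 2 + 1 : ℕ) : ℝ) := vonMangoldt_le_log
    _ ≤ Real.log ((x : ℝ) ^ 2 + 1) := by
        push_cast
        exact Real.log_le_log (by positivity) (by nlinarith)

/-- The proper-prime-power part is `o(x)`: `≤ c x` for every `c > 0`, eventually. -/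
theorem eventually_properPrimePow_sum_le {c : ℝ} (hc : 0 < c) :
    ∀ᶠ x : ℕ in atTop,
      ∑ n ∈ (Icc 1 x).filter
          (fun n : ℕ => ¬Nat.Prime (n ^ 2 + 1) ∧ IsPrimePow (n ^ 2 + 1)), Λ (n ^ 2 + 1)
        ≤ c * x := by
  have h1 : ∀ᶠ y : ℝ in atTop, 5184 / c ≤ y ^ (1 / 6 : ℝ) :=
    (tendsto_rpow_atTop (by norm_num)).eventually_ge_atTop _
  filter_upwards [tendsto_natCast_atTop_atTop.eventually h1, eventually_ge_atTop 3]
    with x hx hx3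
  have hX : (3 : ℝ) ≤ x := by exact_mod_cast hx3
  have hX0 : (0 : ℝ) < x := by linarith
  have hlogN : 0 ≤ Real.log ((x : ℝ) ^ 2 + 1) := Real.log_nonneg (by nlinarith)
  have hlog1 : Real.log ((x : ℝ) ^ 2 + 1) ≤ 3 * Real.log x := by
    have hcube : (x : ℝ) ^ 2 + 1 ≤ (x : ℝ) ^ 3 := by nlinarith
    calc Real.log ((x : ℝ) ^ 2 + 1) ≤ Real.log ((x : ℝ) ^ 3) :=
          Real.log_le_log (by positivity) hcube
      _ = 3 * Real.log x := by rw [Real.log_pow]; norm_num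
  have hlog2 : Real.log x ≤ 12 * (x : ℝ) ^ (1 / 12 : ℝ) := by
    have h := Real.log_le_rpow_div hX0.le (by norm_num : (0 : ℝ) < 1 / 12)
    have h' : (x : ℝ) ^ (1 / 12 : ℝ) / (1 / 12) = 12 * (x : ℝ) ^ (1 / 12 : ℝ) := by ring
    linarith
  have hl3 : Real.log ((x : ℝ) ^ 2 + 1) ≤ 36 * (x : ℝ) ^ (1 / 12 : ℝ) := by linarith
  have hsq : Real.log ((x : ℝ) ^ 2 + 1) * Real.log ((x : ℝ) ^ 2 + 1)
      ≤ (36 * (x : ℝ) ^ (1 / 12 : ℝ)) * (36 * (x : ℝ) ^ (1 / 12 : ℝ)) :=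
    mul_le_mul hl3 hl3 hlogN (by positivity)
  have hpow : (x : ℝ) ^ (1 / 12 : ℝ) * (x : ℝ) ^ (1 / 12 : ℝ) * (x : ℝ) ^ (2 / 3 : ℝ)
      = (x : ℝ) ^ (5 / 6 : ℝ) := by
    rw [← Real.rpow_add hX0, ← Real.rpow_add hX0]; norm_num
  have hx1 : (x : ℝ) ^ (1 / 6 : ℝ) * (x : ℝ) ^ (5 / 6 : ℝ) = x := by
    rw [← Real.rpow_add hX0]; norm_num
  have hcx : 5184 ≤ c * (x : ℝ) ^ (1 / 6 : ℝ) := (div_le_iff₀' hc).mp hx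
  have hA := (properPrimePow_sum_le x).trans
    (mul_le_mul_of_nonneg_right (card_properPrimePow_real_le (by omega)) hlogN)
  calc _ ≤ 4 * Real.log ((x : ℝ) ^ 2 + 1) * (x : ℝ) ^ (2 / 3 : ℝ)
          * Real.log ((x : ℝ) ^ 2 + 1) := hA
    _ = 4 * (Real.log ((x : ℝ) ^ 2 + 1) * Real.log ((x : ℝ) ^ 2 + 1))
          * (x : ℝ) ^ (2 / 3 : ℝ) := by ring
    _ ≤ 4 * ((36 * (x : ℝ) ^ (1 / 12 : ℝ)) * (36 * (x : ℝ) ^ (1 / 12 : ℝ)))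
          * (x : ℝ) ^ (2 / 3 : ℝ) :=
        mul_le_mul_of_nonneg_right (mul_le_mul_of_nonneg_left hsq (by norm_num))
          (by positivity)
    _ = 5184 * ((x : ℝ) ^ (1 / 12 : ℝ) * (x : ℝ) ^ (1 / 12 : ℝ)
          * (x : ℝ) ^ (2 / 3 : ℝ)) := by ring
    _ = 5184 * (x : ℝ) ^ (5 / 6 : ℝ) := by rw [hpow]
    _ ≤ (c * (x : ℝ) ^ (1 / 6 : ℝ)) * (x : ℝ) ^ (5 / 6 : ℝ) :=
        mul_le_mul_of_nonneg_right hcx (by positivity)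
    _ = c * x := by rw [mul_assoc, hx1]

end Summit.Parity.BatemanHorn.Theorems
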